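/-
Copyright (c) 2026 the pub-hodgecm-mathlib formalisation cell (harness21).  Prover seat hodgecm-mathlib-K2E1-p09 (g3), Track B ∕ K2-LIT,
h413 = `stmt-HodgeConjecture-24833`, line `K2_E1_TraceFormulaBeta`, campaign RES-RANK-ONE, brick (H2), file F3b: the cuspidality criterion on the automorphic
quotient, in the currency of ★ `ConstantTermVanishes`.  2026-09-04.
-/
import Summits.HodgeConjecture.HodgeConjecture.Theorems.K2E1PseudoEisensteinCuspidalCriterion   -- ★ F3a: the generic criterion
import Mathlib.MeasureTheory.Measure.Haar.Unique
import HarnessLib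

/-!
# h413 ∕ Track B «K2-LIT», campaign RES-RANK-ONE, brick (H2) file F3b — helper `K2E1PseudoEisensteinCuspidalCriterionAdelic`:
# on `X = G(𝔸) ⧸ G(K)`: `ψ` continuous and `⟨θ_Φ, ψ⟩ = 0` for all pseudo-Eisenstein series along `N_i` ⟹ ★ `ConstantTermVanishes 𝔓 ψ i`

Cell `pub/hodgecm-mathlib`, crux H413 = `stmt-HodgeConjecture-24833`, route `HCCMUnconditional`; chair K2-lead (g0), dealer K2E1-plan (g2), DEAL (H2) ∕ ruling
02:21:21Z.  THEOREMS ONLY (no `def`, no `instance`, no `notation`, no named-fact hypothesis, no `sorry`); lane `--kind proof --supports stmt-HodgeConjecture-24833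
--as helper` (count-neutral).

★ F3a `setIntegral_constantTerm_eq_zero_of_forall_pseudoEisenstein` is stated for ONE inversion-invariant Haar measure on the radical and the subtype Borel structure;
★ `AdelicGroupData.ConstantTermVanishes 𝔓 ψ i` quantifies over EVERY Borel structure on `N_i(𝔸)`, EVERY Haar measure `ν` and EVERY fundamental domain `𝓕` of
`N_i(K)`, and also asks for the integrability of the constant-term integrand on `𝓕`.  This file bridges the two for an adelic group datum `𝒢` with `A_G = 1`
(`hQ : quotientSubgroup = arithmeticSubgroup`, ★ `cmDatum`), `G(K)` discrete, `N_i(𝔸)` closed with an inversion-invariant Haar measure `ν_N` and `N_i(K)` CO-COMPACT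
in it (★ `exists_isCompact_rational_smul_mem_of_eq_three` currency), `μ` AUTOMORPHIC and an invariant measure `μ_N` on `G(𝔸) ⧸ N_i(𝔸)` positive on non-empty open sets:
* **`constantTermVanishes_of_forall_pseudoEisenstein`** — for CONTINUOUS `ψ : X → ℂ` with `∫_X θ_Φ · conj ψ dμ = 0` for every Borel right-`N_i(𝔸)`-invariant `Φ` on the
  pairing domain `∫⁻_X θ_{‖Φ‖}‖ψ‖ dμ < ∞`: `ConstantTermVanishes 𝔓 ψ i` (any two Borel structures on `N_i(𝔸)` coincide, Mathlib `BorelSpace.measurable_eq`; any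
  Haar measure is `c • ν_N`, Mathlib `isMulLeftInvariant_eq_smul`, so fundamental domains, integrability and the vanishing transfer; ★ F3a for `ν_N`);
* `mem_cuspForms_of_forall_constantTermVanishes` ∕ `toLp_mem_cuspidalSubspace_of_forall_constantTermVanishes` — bookkeeping: a continuous square-integrable
  `ψ` all of whose constant terms vanish is a ★ `cuspForms` element and `[ψ] ∈ L²_cusp` (★ `toLp_mem_cuspidalSubspace`); with the first theorem at every
  index `i` this is «`ψ ⊥ θ_Φ` for all `Φ`, `i` ⟹ `ψ` cuspidal» for continuous `ψ`.

WHAT IS NOT HERE.  The same for arbitrary `ψ ∈ L²` (density of continuous cusp forms, `(L²_cusp)ᗮ = closure span θ_Φ`: (H2)-d, re-dealt); the discharge of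
`μ_N`, `ν_N`, co-compactness and `θ_{‖Φ‖} ∈ L²` for `U(Φ₂)`, `U(Φ₃)` (★ Siegel-domain files; assembly not here).

HONEST LABEL.  Count-neutral helper; proves no printed statement; HC_CM is proved only modulo the 7 printed citations (2 remaining named inputs: hLiu418 =
`stmt-HodgeConjecture-24832`, h413 = `stmt-HodgeConjecture-24833`) until rung 0 closes.

## References
* [MoeglinWaldspurger1995] C. Mœglin, J.-L. Waldspurger, *Spectral decomposition and Eisenstein series* (1995), II.1.3, I.2.6.
* [BorelJacquet1979] A. Borel, H. Jacquet, *Automorphic forms and automorphic representations*, PSPM 33.1 (1979), §4.4–4.6.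
-/

set_option autoImplicit false
set_option linter.dupNamespace false  -- the mandated namespace repeats the summit's segment (`HodgeConjecture.HodgeConjecture`)

noncomputable section

open MeasureTheory Measure Set Filter Topology
open Literature.MeasureTheory.Group Literature.NumberTheory.Automorphic
open Summit.HodgeConjecture.HodgeConjecture.Cruxes.H413.K2E1PseudoEisensteinUnfolding
open Summit.HodgeConjecture.HodgeConjecture.Cruxes.H413.K2E1PseudoEisensteinCuspidalCriterion
open scoped ENNReal NNReal Pointwise ComplexConjugate

namespace Summit.HodgeConjecture.HodgeConjecture.Cruxes.H413.K2E1PseudoEisensteinCuspidalCriterionAdelic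

section Adelic

variable {K : Type} [Field K] [NumberField K] (𝒢 : AdelicGroupData K)
  [MeasurableSpace 𝒢.Adelic] [BorelSpace 𝒢.Adelic] [LocallyCompactSpace 𝒢.Adelic] [SecondCountableTopology 𝒢.Adelic] [T2Space 𝒢.Adelic]
  [DiscreteTopology 𝒢.quotientSubgroup] (hQ : 𝒢.quotientSubgroup = 𝒢.arithmeticSubgroup)
  (𝔓 : 𝒢.ParabolicUnipotentData) (i : 𝔓.ι) [hN : IsClosed ((𝔓.radical i : Subgroup 𝒢.Adelic) : Set 𝒢.Adelic)]
  (μ : Measure 𝒢.automorphicQuotient) [𝒢.IsAutomorphicMeasure μ]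
  [MeasurableSpace (𝒢.Adelic ⧸ 𝔓.radical i)] [BorelSpace (𝒢.Adelic ⧸ 𝔓.radical i)]
  (μN : Measure (𝒢.Adelic ⧸ 𝔓.radical i)) [SMulInvariantMeasure 𝒢.Adelic (𝒢.Adelic ⧸ 𝔓.radical i) μN] [IsFiniteMeasureOnCompacts μN] [μN.IsOpenPosMeasure]
  (νN : Measure (𝔓.radical i)) [IsHaarMeasure νN] [νN.IsInvInvariant]

include hQ μN νN in
/-- **THE CUSPIDALITY CRITERION ALONG `N_i` ON `X = G(𝔸) ⧸ G(K)`** in the currency of ★ `ConstantTermVanishes`: for CONTINUOUS `ψ : X → ℂ` with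
`∫_X θ_Φ · conj ψ dμ = 0` for every Borel right-`N_i(𝔸)`-invariant `Φ : G(𝔸) → ℂ` with `∫⁻_X θ_{‖Φ‖}‖ψ‖ dμ < ∞` (given `N_i(K)` co-compact in `N_i(𝔸)`, an
inversion-invariant Haar `ν_N` on `N_i(𝔸)`, an invariant `μ_N` on `G(𝔸)⧸N_i(𝔸)` positive on open sets): ALL constant terms of `ψ` along `N_i` vanish, for every Borel
structure, Haar measure and fundamental domain. [cite: MoeglinWaldspurger1995, II.1.3] [cite: BorelJacquet1979, §4.4] -/
theorem constantTermVanishes_of_forall_pseudoEisenstein (hcpt : ∃ C : Set (𝔓.radical i), IsCompact C ∧ ∀ u : 𝔓.radical i, ∃ l : 𝔓.rational i, l • u ∈ C)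
    {ψ : 𝒢.automorphicQuotient → ℂ} (hψ : Continuous ψ)
    (horth : ∀ Φ : 𝒢.Adelic → ℂ, Measurable Φ → (∀ (g : 𝒢.Adelic) (n : 𝔓.radical i), Φ (g * n) = Φ g) →
      ∫⁻ x, (∑' q : 𝒢.quotientSubgroup ⧸ (𝔓.radical i).subgroupOf 𝒢.quotientSubgroup,
          ‖Φ ((Quotient.out x : 𝒢.Adelic) * ((q.out : 𝒢.quotientSubgroup) : 𝒢.Adelic))‖ₑ) * ‖ψ x‖ₑ ∂μ < ∞ →
        ∫ x, (∑' q : 𝒢.quotientSubgroup ⧸ (𝔓.radical i).subgroupOf 𝒢.quotientSubgroup,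
          Φ ((Quotient.out x : 𝒢.Adelic) * ((q.out : 𝒢.quotientSubgroup) : 𝒢.Adelic))) * conj (ψ x) ∂μ = 0) :
    AdelicGroupData.ConstantTermVanishes 𝔓 ψ i := by
  intro mN hB ν hν 𝓕 h𝓕 x
  -- any Borel structure on `N_i(𝔸)` is the subtype one
  have hmN : mN = (Subtype.instMeasurableSpace : MeasurableSpace (𝔓.radical i)) :=
    hB.measurable_eq.trans (@BorelSpace.measurable_eq _ _ Subtype.instMeasurableSpace
      (Subtype.borelSpace ((𝔓.radical i : Subgroup 𝒢.Adelic) : Set 𝒢.Adelic))).symm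
  subst hmN
  -- the house instances on the automorphic quotient and the closed subgroup `N_i(𝔸)`
  letI := AdelicGroupData.measurableSpaceQuotientForm 𝒢
  haveI := AdelicGroupData.borelSpaceQuotientForm 𝒢
  haveI := AdelicGroupData.smulInvariantMeasureQuotientForm 𝒢 μ
  haveI := AdelicGroupData.isFiniteMeasureOnCompactsQuotientForm 𝒢 μ
  haveI : LocallyCompactSpace (𝔓.radical i) := hN.isClosedEmbedding_subtypeVal.locallyCompactSpace
  haveI : SecondCountableTopology (𝔓.radical i) := TopologicalSpace.Subtype.secondCountableTopology _
  haveI : SigmaFinite νN := by infer_instance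
  -- co-compactness and the fundamental domain in the `Γ ∩ N` currency of ★ F3a
  obtain ⟨C, hC, hcov⟩ := hcpt
  have hcov' : ∀ u : 𝔓.radical i, ∃ δ : (𝒢.quotientSubgroup).subgroupOf (𝔓.radical i), δ • u ∈ C := fun u => by
    obtain ⟨l, hl⟩ := hcov u
    exact ⟨⟨(l : 𝔓.radical i), by rw [← rational_eq_subgroupOf 𝒢 hQ 𝔓 i]; exact l.2⟩, hl⟩
  -- `ν = c • ν_N`, `c ≠ 0`
  have hνeq : ν = haarScalarFactor ν νN • νN := isMulLeftInvariant_eq_smul ν νN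
  have hc0 : haarScalarFactor ν νN ≠ 0 := (haarScalarFactor_pos_of_isHaarMeasure ν νN).ne'
  have hac : νN ≪ ν := by
    refine Measure.AbsolutelyContinuous.mk fun s _ hs => ?_
    rw [hνeq, Measure.smul_apply, ENNReal.smul_def, smul_eq_mul, mul_eq_zero] at hs
    exact hs.resolve_left (ENNReal.coe_ne_zero.2 hc0)
  have h𝓕' : IsFundamentalDomain ((𝒢.quotientSubgroup).subgroupOf (𝔓.radical i)) 𝓕 νN := by
    rw [← rational_eq_subgroupOf 𝒢 hQ 𝔓 i]
    exact h𝓕.mono hac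
  -- ★ F3a for `ν_N`
  have hint := integrableOn_constantTerm 𝒢.quotientSubgroup (𝔓.radical i) νN (ψ := ψ) hψ hC hcov' h𝓕' x
  have hzero := setIntegral_constantTerm_eq_zero_of_forall_pseudoEisenstein 𝒢.quotientSubgroup (𝔓.radical i) μ μN haar νN
    (AdelicGroupData.IsAutomorphicMeasure.ne_zero 𝒢 μ) hψ hC hcov' horth h𝓕' x
  -- transfer to `ν = c • ν_N`
  refine ⟨?_, ?_⟩
  · rw [IntegrableOn, hνeq, Measure.restrict_smul]
    exact hint.smul_measure ENNReal.coe_ne_top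
  · rw [hνeq, Measure.restrict_smul, integral_smul_nnreal_measure]
    change haarScalarFactor ν νN • ∫ u in 𝓕, ψ (QuotientGroup.mk (x * (u : 𝒢.Adelic)⁻¹)) ∂νN = 0
    rw [hzero, smul_zero]

omit [MeasurableSpace 𝒢.Adelic] [BorelSpace 𝒢.Adelic] [LocallyCompactSpace 𝒢.Adelic] [SecondCountableTopology 𝒢.Adelic] [T2Space 𝒢.Adelic]
  [DiscreteTopology 𝒢.quotientSubgroup] hN [𝒢.IsAutomorphicMeasure μ] [MeasurableSpace (𝒢.Adelic ⧸ 𝔓.radical i)] [BorelSpace (𝒢.Adelic ⧸ 𝔓.radical i)] in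
/-- Bookkeeping: a continuous square-integrable `ψ` on `X` all of whose constant terms vanish is a ★ `cuspForms` element (the definition). [cite: BorelJacquet1979, §4.4] -/
theorem mem_cuspForms_of_forall_constantTermVanishes {ψ : 𝒢.automorphicQuotient → ℂ} (hψ : Continuous ψ) (hψ2 : MemLp ψ 2 μ)
    (hCT : ∀ j : 𝔓.ι, AdelicGroupData.ConstantTermVanishes 𝔓 ψ j) : ψ ∈ 𝒢.cuspForms μ 𝔓 :=
  ⟨hψ, hψ2, hCT⟩

omit [MeasurableSpace 𝒢.Adelic] [BorelSpace 𝒢.Adelic] [LocallyCompactSpace 𝒢.Adelic] [SecondCountableTopology 𝒢.Adelic] [T2Space 𝒢.Adelic]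
  [DiscreteTopology 𝒢.quotientSubgroup] hN [MeasurableSpace (𝒢.Adelic ⧸ 𝔓.radical i)] [BorelSpace (𝒢.Adelic ⧸ 𝔓.radical i)] in
/-- … hence its `L²` class lies in the cuspidal subspace `L²_cusp` (★ `toLp_mem_cuspidalSubspace`).  With `constantTermVanishes_of_forall_pseudoEisenstein` at every
index `j` this is «`[ψ] ⊥ θ_Φ` for all `Φ` and all `j` ⟹ `[ψ] ∈ L²_cusp`» for CONTINUOUS square-integrable `ψ`. [cite: MoeglinWaldspurger1995, II.1.3] -/
theorem toLp_mem_cuspidalSubspace_of_forall_constantTermVanishes {ψ : 𝒢.automorphicQuotient → ℂ} (hψ : Continuous ψ) (hψ2 : MemLp ψ 2 μ)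
    (hCT : ∀ j : 𝔓.ι, AdelicGroupData.ConstantTermVanishes 𝔓 ψ j) : hψ2.toLp ψ ∈ 𝒢.cuspidalSubspace μ 𝔓 :=
  AdelicGroupData.toLp_mem_cuspidalSubspace (mem_cuspForms_of_forall_constantTermVanishes 𝒢 𝔓 μ hψ hψ2 hCT)

end Adelic

end Summit.HodgeConjecture.HodgeConjecture.Cruxes.H413.K2E1PseudoEisensteinCuspidalCriterionAdelic

end
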